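import Mathlib
import HarnessLib

/-!
# `NoHeavyLowerTail` (crux stmt-CriticalPhenomena-4575), antithetic vdBHK programme: the WEDGE GLUING `T(X;L)` as an explicit ordered set —
# partial-order axioms and the UP-SET DICTIONARY (up-sets of `T(X;L)` = T-pattern quadruples)

Support file (seat `prim-ineq-gen-7` gen 51; `--supports stmt-CriticalPhenomena-4575`).  No `sorry`, no definitions.  Memo: FINDING-FENCE-g51.md §1.

`AntitheticWedgeTransfer.wedge_transfer` (this generation) proves the antipodal-Kleitman inequality of the wedge gluing `T(X;L)` in QUADRUPLE FORM,
relying on the dictionary 'up-sets of `T(X;L)` = T-pattern quadruples of up-sets of `X`' stated in its docstring.  This file makes the dictionary a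
theorem.  The carrier is `X × Fin 4` (sheet `0 = RB, 1 = RR, 2 = BB, 3 = BR`: colours of the new atom `c` and the new top `x > a, c`, `L = {a red}`),
the relation (spelled out inline in every statement; no definitions in this file) is: `p.1 ≤ q.1` and the SHEET CONDITION: same sheet, or `RB→BB`, `RR→BR`, `RB→BR` (always),
`BB→BR` (source in `L`), `RB→RR` (target outside `L`), `RR→BB` (source in `L`, target outside `L`); nothing else.
* `tle_refl`, `tle_trans` (for a down-set `L`), `tle_antisymm` — the relation is a partial order on `X × Fin 4`.
* `upset_iff` — a finite `U ⊆ X × Fin 4` is up-closed for the relation iff its sheets `U_i = {s : (s,i) ∈ U}` are up-sets of `X` with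
  `U₀ ⊆ U₂`, `U₁ ⊆ U₃`, `U₂ ∩ L ⊆ U₃`, `U₀ ∖ L ⊆ U₁`, `s ∈ U₂ ∩ L, s ≤ t, t ∉ L ⟹ t ∈ U₃`, `s ∈ U₁ ∩ L, s ≤ t, t ∉ L ⟹ t ∈ U₂` — the T-PATTERN of
  `wedge_transfer` (there indexed `1..4`).
For `X = Ω_Q` and `L = {a red}` the ordered set `X × Fin 4` (with this relation) is the colouring poset `Ω_{Q ∪ {c,x}}`, `x > a, c` (machine-checked, memo §1), so
with `wedge_transfer` every exact instance of the rearrangement inequality (R) — all rooted posets with ≤ 4 elements, the W-fence at its end atoms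
(kit j284847) — is an AK colouring poset one wedge larger (e.g. `Ω_{F_7}`).
-/

namespace Summit.CriticalPhenomena.PercolationContinuityZ3.Theorems

open Finset

namespace AntitheticWedgePoset

variable {X : Type*} [PartialOrder X]

/-- The wedge-gluing relation is reflexive. [this work] -/
theorem tle_refl (L : Finset X) (p : X × Fin 4) :
    (p.1 ≤ p.1 ∧ (p.2 = p.2 ∨ (p.2 = 0 ∧ p.2 = 2) ∨ (p.2 = 1 ∧ p.2 = 3) ∨ (p.2 = 0 ∧ p.2 = 3) ∨ (p.2 = 2 ∧ p.2 = 3 ∧ p.1 ∈ L) ∨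
        (p.2 = 0 ∧ p.2 = 1 ∧ p.1 ∉ L) ∨ (p.2 = 1 ∧ p.2 = 2 ∧ p.1 ∈ L ∧ p.1 ∉ L))) :=
  ⟨le_rfl, Or.inl rfl⟩

/-- The wedge-gluing relation is transitive when `L` is a down-set (64 sheet cases). [this work] -/
theorem tle_trans (L : Finset X) (hLdown : ∀ x y : X, x ≤ y → y ∈ L → x ∈ L) (p q r : X × Fin 4)
    (hpq : (p.1 ≤ q.1 ∧ (p.2 = q.2 ∨ (p.2 = 0 ∧ q.2 = 2) ∨ (p.2 = 1 ∧ q.2 = 3) ∨ (p.2 = 0 ∧ q.2 = 3) ∨ (p.2 = 2 ∧ q.2 = 3 ∧ p.1 ∈ L) ∨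
        (p.2 = 0 ∧ q.2 = 1 ∧ q.1 ∉ L) ∨ (p.2 = 1 ∧ q.2 = 2 ∧ p.1 ∈ L ∧ q.1 ∉ L))))
    (hqr : (q.1 ≤ r.1 ∧ (q.2 = r.2 ∨ (q.2 = 0 ∧ r.2 = 2) ∨ (q.2 = 1 ∧ r.2 = 3) ∨ (q.2 = 0 ∧ r.2 = 3) ∨ (q.2 = 2 ∧ r.2 = 3 ∧ q.1 ∈ L) ∨
        (q.2 = 0 ∧ r.2 = 1 ∧ r.1 ∉ L) ∨ (q.2 = 1 ∧ r.2 = 2 ∧ q.1 ∈ L ∧ r.1 ∉ L)))) :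
    (p.1 ≤ r.1 ∧ (p.2 = r.2 ∨ (p.2 = 0 ∧ r.2 = 2) ∨ (p.2 = 1 ∧ r.2 = 3) ∨ (p.2 = 0 ∧ r.2 = 3) ∨ (p.2 = 2 ∧ r.2 = 3 ∧ p.1 ∈ L) ∨
        (p.2 = 0 ∧ r.2 = 1 ∧ r.1 ∉ L) ∨ (p.2 = 1 ∧ r.2 = 2 ∧ p.1 ∈ L ∧ r.1 ∉ L))) := by
  obtain ⟨s, i⟩ := p
  obtain ⟨t, j⟩ := q
  obtain ⟨u, k⟩ := r
  obtain ⟨hst, c1⟩ := hpq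
  obtain ⟨htu, c2⟩ := hqr
  refine ⟨le_trans hst htu, ?_⟩
  simp only at hst htu c1 c2 ⊢
  -- membership transport along the chain s ≤ t ≤ u
  have d1 : t ∈ L → s ∈ L := fun h => hLdown s t hst h
  have d2 : u ∈ L → t ∈ L := fun h => hLdown t u htu h
  have u1 : s ∉ L → t ∉ L := fun h ht => h (d1 ht)
  have u2 : t ∉ L → u ∉ L := fun h hu => h (d2 hu)
  fin_cases i <;> fin_cases j <;> fin_cases k <;> simp at c1 c2 ⊢ <;> tauto

/-- The wedge-gluing relation is antisymmetric (the sheet condition has no 2-cycles). [this work] -/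
theorem tle_antisymm (L : Finset X) (p q : X × Fin 4)
    (hpq : (p.1 ≤ q.1 ∧ (p.2 = q.2 ∨ (p.2 = 0 ∧ q.2 = 2) ∨ (p.2 = 1 ∧ q.2 = 3) ∨ (p.2 = 0 ∧ q.2 = 3) ∨ (p.2 = 2 ∧ q.2 = 3 ∧ p.1 ∈ L) ∨
        (p.2 = 0 ∧ q.2 = 1 ∧ q.1 ∉ L) ∨ (p.2 = 1 ∧ q.2 = 2 ∧ p.1 ∈ L ∧ q.1 ∉ L))))
    (hqp : (q.1 ≤ p.1 ∧ (q.2 = p.2 ∨ (q.2 = 0 ∧ p.2 = 2) ∨ (q.2 = 1 ∧ p.2 = 3) ∨ (q.2 = 0 ∧ p.2 = 3) ∨ (q.2 = 2 ∧ p.2 = 3 ∧ q.1 ∈ L) ∨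
        (q.2 = 0 ∧ p.2 = 1 ∧ p.1 ∉ L) ∨ (q.2 = 1 ∧ p.2 = 2 ∧ q.1 ∈ L ∧ p.1 ∉ L)))) : p = q := by
  obtain ⟨s, i⟩ := p
  obtain ⟨t, j⟩ := q
  obtain ⟨hst, c1⟩ := hpq
  obtain ⟨hts, c2⟩ := hqp
  simp only at hst hts c1 c2
  have hs : s = t := le_antisymm hst hts
  subst hs
  fin_cases i <;> fin_cases j <;> simp at c1 c2 ⊢

/-- **UP-SET DICTIONARY.**  For a down-set `L` and a finite `U ⊆ X × Fin 4`: `U` is up-closed for the wedge-gluing relation iff its four sheets are up-sets of `X`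
satisfying the T-pattern (the dictionary behind `AntitheticWedgeTransfer.wedge_transfer`). [this work] -/
theorem upset_iff (L : Finset X) (hLdown : ∀ x y : X, x ≤ y → y ∈ L → x ∈ L) (U : Finset (X × Fin 4)) :
    (∀ p q : X × Fin 4,
        (p.1 ≤ q.1 ∧ (p.2 = q.2 ∨ (p.2 = 0 ∧ q.2 = 2) ∨ (p.2 = 1 ∧ q.2 = 3) ∨ (p.2 = 0 ∧ q.2 = 3) ∨ (p.2 = 2 ∧ q.2 = 3 ∧ p.1 ∈ L) ∨
        (p.2 = 0 ∧ q.2 = 1 ∧ q.1 ∉ L) ∨ (p.2 = 1 ∧ q.2 = 2 ∧ p.1 ∈ L ∧ q.1 ∉ L))) →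
        p ∈ U → q ∈ U) ↔
      ((∀ i : Fin 4, ∀ s t : X, s ≤ t → (s, i) ∈ U → (t, i) ∈ U) ∧
        (∀ s, (s, (0 : Fin 4)) ∈ U → (s, (2 : Fin 4)) ∈ U) ∧
        (∀ s, (s, (1 : Fin 4)) ∈ U → (s, (3 : Fin 4)) ∈ U) ∧
        (∀ s, s ∈ L → (s, (2 : Fin 4)) ∈ U → (s, (3 : Fin 4)) ∈ U) ∧
        (∀ s, s ∉ L → (s, (0 : Fin 4)) ∈ U → (s, (1 : Fin 4)) ∈ U) ∧
        (∀ s t, s ≤ t → s ∈ L → t ∉ L → (s, (2 : Fin 4)) ∈ U → (t, (3 : Fin 4)) ∈ U) ∧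
        (∀ s t, s ≤ t → s ∈ L → t ∉ L → (s, (1 : Fin 4)) ∈ U → (t, (2 : Fin 4)) ∈ U)) := by
  constructor
  · intro hU
    refine ⟨?_, ?_, ?_, ?_, ?_, ?_, ?_⟩
    · intro i s t hst hs
      exact hU (s, i) (t, i) ⟨hst, Or.inl rfl⟩ hs
    · intro s hs
      exact hU (s, 0) (s, 2) ⟨le_rfl, by simp⟩ hs
    · intro s hs
      exact hU (s, 1) (s, 3) ⟨le_rfl, by simp⟩ hs
    · intro s hL hs
      exact hU (s, 2) (s, 3) ⟨le_rfl, by simp [hL]⟩ hs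
    · intro s hL hs
      exact hU (s, 0) (s, 1) ⟨le_rfl, by simp [hL]⟩ hs
    · intro s t hst hsL htL hs
      exact hU (s, 2) (t, 3) ⟨hst, by simp [hsL]⟩ hs
    · intro s t hst hsL htL hs
      exact hU (s, 1) (t, 2) ⟨hst, by simp [hsL, htL]⟩ hs
  · rintro ⟨hup, h02, h13, h23, h01, hC23, hC12⟩ p q hpq hp
    obtain ⟨s, i⟩ := p
    obtain ⟨t, j⟩ := q
    obtain ⟨hst, c⟩ := hpq
    simp only at hst c
    -- move within the sheet first, then change sheet at the target point (or change at the source, then move)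
    rcases c with h | ⟨hi, hj⟩ | ⟨hi, hj⟩ | ⟨hi, hj⟩ | ⟨hi, hj, hsL⟩ | ⟨hi, hj, htL⟩ | ⟨hi, hj, hsL, htL⟩
    · subst h; exact hup i s t hst hp
    · subst hi; subst hj; exact hup 2 s t hst (h02 s hp)
    · subst hi; subst hj; exact hup 3 s t hst (h13 s hp)
    · subst hi; subst hj
      -- RB → BR: through BB if s ∈ L, through RR at the target otherwise
      by_cases hsL : s ∈ L
      · exact hup 3 s t hst (h23 s hsL (h02 s hp))
      · have htL : t ∉ L := fun h => hsL (hLdown s t hst h)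
        exact h13 t (h01 t htL (hup 0 s t hst hp))
    · subst hi; subst hj; exact hup 3 s t hst (h23 s hsL hp)
    · subst hi; subst hj; exact h01 t htL (hup 0 s t hst hp)
    · subst hi; subst hj; exact hC12 s t hst hsL htL hp

end AntitheticWedgePoset

end Summit.CriticalPhenomena.PercolationContinuityZ3.Theorems
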